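import Summits.HubbardSuperconductivity.HubbardSuperconductivity.Theorems.AnisotropyChordTransferFibre3Hole2L35a
import Summits.HubbardSuperconductivity.HubbardSuperconductivity.Theorems.AnisotropyChordTransferFibre3Hole2L35b
import Summits.HubbardSuperconductivity.HubbardSuperconductivity.Theorems.AnisotropyChordTransferFibre3Hole2L35c
import Summits.HubbardSuperconductivity.HubbardSuperconductivity.Theorems.AnisotropyChordTransferFibre3Hole2L35d
import Summits.HubbardSuperconductivity.HubbardSuperconductivity.Theorems.AnisotropyChordTransferFibre3Hole2Cover

/-!
# Route `AnisotropyChord` / H0 rotor rung: ★ HOLE₂(.75) AT `L = 35` — `TwoHoleGap 35 (3/4·eps1 35)`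

The one-body spectral input of the GM₃ assembly `gm3_of_hole2` (p1 g23) at side length `L = 35` (first side lengths of the analytic
regime above the FIN range `9 ≤ L ≤ 32` of `…Hole2FinRange`): the Neumann gap of the rate-½ walk on the `35 × 35` torus with ANY two
vertices deleted is at least `¾ε₁(35)`.  Assembly of the kernel facts `checkRepsQ_35a…` (4 parts, the 170 `D₄`-classes `repList 35`)
via `checkRepsQ_append`, the identification with `repList 35` (`decide`), and `Hole2.twoHoleGap_of_checkRepsQ_repList` (`…Fibre3Hole2Cover`).
Prover seat `hubbard-h0-rotor-p3` g3; helper for stmt-HubbardSuperconductivity-19089 (`--supports`, helper class).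
WHAT THIS IS NOT: nothing here proves superconductivity in the Hubbard model (rotor TARGET as worded stays FALSE, g15 verdict); this
discharges, at ONE side length, ONE hypothesis (HOLE₂(.75)) of ONE conditional reduction (rung 19089). Tree imports only; no sorry.
-/

set_option linter.dupNamespace false
set_option autoImplicit false

namespace Summit.HubbardSuperconductivity.HubbardSuperconductivity.Theorems.AnisotropyChord.Transfer.Fibre3

namespace Hole2

/-- the kernel-fact parts list exactly `repList 35`. [folklore] -/
theorem repList_35_eq : repList 35 = reps35a ++ reps35b ++ reps35c ++ reps35d := by
  decide +kernel

/-- every representative separation of the `35 × 35` torus passes the kernel check. [folklore] -/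
theorem checkRepsQ_repList_35 : checkRepsQ 35 (repList 35) = true := by
  rw [repList_35_eq]
  exact checkRepsQ_append (checkRepsQ_append (checkRepsQ_append (checkRepsQ_35a) checkRepsQ_35b) checkRepsQ_35c) checkRepsQ_35d

/-- ★★★ HOLE₂(.75) AT `L = 35`: `TwoHoleGap 35 (3/4 * eps1 35)`, the spectral hypothesis of `gm3_of_hole2` at `L = 35`. [folklore] -/
theorem twoHoleGap_thirtyFive : TwoHoleGap 35 (3 / 4 * eps1 35) :=
  twoHoleGap_of_checkRepsQ_repList 35 checkRepsQ_repList_35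

end Hole2

end Summit.HubbardSuperconductivity.HubbardSuperconductivity.Theorems.AnisotropyChord.Transfer.Fibre3
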